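import Summits.BirchSwinnertonDyer.Rank1Residual.X4.KuriharaAdditiveCertificate
import Summits.BirchSwinnertonDyer.Rank1Residual.X4.KimDefectLevelLoweringModPow
import Summits.BirchSwinnertonDyer.Rank1Residual.X4.KimDefectLevelLoweringModPowRankOne
import HarnessLib

/-!
# TAM-DEFECT rows CLOSE from the ADDITIVE (two-prime `τ`-system) mod-`p^e` level-lowering certificate: `∂^{(∞)}(δ̃) ≥ e` with `e = e₁ + e₂` the JOINT exponent of two defect primes (file `X4/KuriharaAdditiveCertificate.lean`) fed into the one-factor socket (rank `0`: `ord_p ∏ c ≤ e + 1`) and into the level-`e + 1` Cassels–Tate-free closure (rank `1`) (cell `b2b-bsdres`, seat additive-p4 gen 31, line V51′/V52-B; CLASS-CLOSURE §3.1 N11 / §3.2 N10 SPREAD rows, O7 ∩ X4)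

HONEST FRAMING (verbatim, cell `b2b-bsdres`): the goal of the cell is to DELETE the COMBINATION-SHAPED
residual classes for ALL analytic-rank `≤ 1` curves over `ℚ` — "full BSD formula for every rank `≤ 1`
curve in class `C`" assembled STRICTLY from published theorems — so that the rank-`≤ 1` remainder
becomes exactly the CONSTRUCTION-SHAPED classes, which are TYPED (missing-input Props), NOT attempted;
this is not "finishing BSD". This file: research-route consumers of a per-pair FINITE certificate
(`PlusSymbolLevelLowersAdditivelyModAt`, EVIDENCE decided by the cell's instruments E8 FREE / E9b, never a
Literature fact); the published inputs enter BY NAME exactly as in gen 29's `X4/KimDefectLevelLoweringModPow`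
and `…RankOne` (Kim 2026 Thm. 1.8 (6) / E73 at `p ≥ 5`; the ANNOUNCED Kim 2025 clause, flagged
`_OPEN`, at `p ≥ 3`; Cassels–Tate; GZK; modularity); nothing booked; X4 stays CONSTRUCTION-SHAPED; no
mark moves.

## What is proved (every theorem = gen 29's twin with the single-prime certificate replaced by the additive one)

Rank `0`:
* `kimTamagawaDefectGeAt_of_plusSymbolLevelLowersAdditivelyModAt_of_tamagawa_le` (`ord_p ∏ c ≤ e ≤ ∂^{(∞)}`).
* **`bsdp_of_plusSymbolLevelLowersAdditivelyModAt_of_tamagawa_le_succ_of_shaAn_unit_of_five_le`** (`p ≥ 5`,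
  PUBLISHED inputs: analytic rank `0`, `ρ̄` onto, conductor-level datum with `p ∤ c_D` + period
  transfer, `#Ш_an` a `p`-unit, **`ord_p ∏_v c_v ≤ e + 1`**, the additive certificate at `p^e` at
  two divisors `ℓ₁, ℓ₂` of `N_E` ⟹ `BSD(E,p)`) + the optimal-datum variant; the exactness corollary
  `kimTamagawaDefectAt_…` (Conj. 1.10 holds at the pair).
* `…_of_kim2025_OPEN` twins at `p ≥ 3` (tower onto), CONDITIONAL on the preprint clause.

Rank `1` (the `∂`-clause `hK : KimRankOnePartialAt W p` explicit, or from E73 at `p ≥ 5`, or from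
`X4SharpThreeKimRankOnePartial` at `p = 3`):
* `padicValNat_primaryComponent_add_le_of_partial_of_plusSymbolLevelLowersAdditivelyModAt`
  (`ord_p #Ш(p) + e ≤ k − 1` from ONE `δ̃_ℓ ≢ 0 (mod p^k)` at a cyclic `ℓ ∈ 𝒫_k`);
* `card_primaryComponent_eq_one_of_partial_of_plusSymbolLevelLowersAdditivelyModAt_levelSucc` and
  **`bsdp_of_partial_of_plusSymbolLevelLowersAdditivelyModAt_levelSucc_of_shaAn_unit`** (level `e + 1`,
  Cassels–Tate-FREE), `…_rankOne_of_shaAn_unit_of_five_le` (E73), `X4RankOne.bsdp_three_…` (`p = 3`).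

WHY (seat census, gens 29–31): gen 29's single-prime exponent `e = ord_p c_ℓ` leaves (i) the 27 SPREAD
rows of the rank-`0` `ord₃ ∏ c ≥ 3` residue (two Tamagawa primes beyond the socket's one unit of
slack) and (ii) the bulk of the rank-one Tamagawa rows at "level `e + 2` + Cassels–Tate" (`T = e + 1`:
5 999 rows at `p = 3`). Gen 30 measured that EIGEN certificates never exceed `max_ℓ ord_p c_ℓ` while
the component-free decomposition at two primes reaches `e₁ + e₂` exactly (E8 FREE, 21/21) with a
`τ`-system (E9b, 5/5); gen 31 proved that a `τ`-system kills the Kurihara numbers (lemma S and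
`kuriharaSum_twoPrime_eq_zero`). With `e = e₁ + e₂`, (i) enters the socket with no slack and (ii)
drops to level `T + 1`, CT-free. Per pair, on a finite certificate; EVIDENCE; nothing booked.

## References

* C.-H. Kim, Amer. J. Math. 148 (2026), Thm. 1.9 (6), §1.5.1, Conj. 1.10. [cite: Kim2022StructureSelmer, Thm. 1.9 (6) and Conj. 1.10 (PDF p. 8)]
* C.-H. Kim, arXiv:2505.09121 (2025), Thm. 1.1 — ANNOUNCED, binder `_OPEN`. [cite: Kim2025RefinedTNC, Thm. 1.1 (ANNOUNCED, OPEN binder)]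
* J. H. Silverman, *The Arithmetic of Elliptic Curves* (2009), Thm. X.4.14 (Cassels–Tate). [cite: SilvermanAEC2009, Thm. X.4.14]
* R. L. Miller, LMS J. Comput. Math. 14 (2011), §1, Def. 1.1 (`BSD(E,p)`). [cite: Miller2011LMS, §1 and Def. 1.1]
* J. E. Cremona, *Algorithms for Modular Elliptic Curves* (1997), §2.8. [cite: CremonaAlgorithms1997, §2.8 (p. 26)]
-/

noncomputable section

open scoped Classical MatrixGroups ModularForm

open CongruenceSubgroup WeierstrassCurve Literature.NumberTheory.EllipticCurves
  Literature.NumberTheory.EllipticCurves.ModularForms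
  Literature.NumberTheory.EllipticCurves.Rank1Residual
  Literature.NumberTheory.EllipticCurves.Rank1Residual.Typed
  Summit.BirchSwinnertonDyer.Rank1Residual.LevelLowering
  Summit.BirchSwinnertonDyer.Rank1Residual.Additive

namespace Summit.BirchSwinnertonDyer.Rank1Residual.X4

variable (W : WeierstrassCurve ℚ) [W.IsElliptic] [W.IsGloballyMinimal] (p : ℕ) [Fact p.Prime]

/-! ### §1 Analytic rank `0`, `p ≥ 5`: published inputs + the additive certificate -/

section RankZeroFiveLe

/-- **The `≥` half of Kim's Conjecture 1.10 on a row with `ord_p ∏_v c_v ≤ e`, from an additive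
mod-`p^e` certificate** at two divisors `ℓ₁, ℓ₂` of `N_E` (`ord_p ∏ c ≤ e ≤ ∂^{(∞)}`). Bookkeeping over
`le_kuriharaPartialInfty_of_plusSymbolLevelLowersAdditivelyModAt`. [cite: Kim2022StructureSelmer, Conj. 1.10 (PDF p. 8)] -/
theorem kimTamagawaDefectGeAt_of_plusSymbolLevelLowersAdditivelyModAt_of_tamagawa_le
    (hp2 : p ≠ 2) (hirr : W.HasIrreducibleModPGaloisRep p)
    {N : ℕ} [NeZero N] (D : ModularParametrizationData W N) (hN : W.conductorNorm ℤ = N)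
    {e : ℕ} {ℓ₁ ℓ₂ : ℕ} (hcert : PlusSymbolLevelLowersAdditivelyModAt W p D.f (p ^ e) ℓ₁ ℓ₂)
    (hℓ₁ : ℓ₁ ∣ W.conductorNorm ℤ) (hℓ₂ : ℓ₂ ∣ W.conductorNorm ℤ)
    (hce : padicValNat p W.tamagawaProduct ≤ e) : KimTamagawaDefectGeAt W p D.f := by
  unfold KimTamagawaDefectGeAt
  calc (padicValNat p W.tamagawaProduct : ℕ∞) ≤ ((e : ℕ) : ℕ∞) := by exact_mod_cast hce
    _ ≤ kuriharaPartialInfty W p D.f :=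
      le_kuriharaPartialInfty_of_plusSymbolLevelLowersAdditivelyModAt hp2 hirr D hN hcert hℓ₁ hℓ₂

/-- **THE `ord_p ∏ c ≤ e + 1` CLOSURE at `p ≥ 5` from the ADDITIVE certificate**: analytic rank `0`,
`ρ̄_{E,p}` onto, conductor-level datum `D` with `p ∤ c_D` and the period transfer, `#Ш_an = q'` a `p`-adic
unit, **`ord_p ∏_v c_v ≤ e + 1`**, and `PlusSymbolLevelLowersAdditivelyModAt W p D.f (p^e) ℓ₁ ℓ₂` at two
divisors `ℓ₁, ℓ₂` of `N_E`: **`BSD(E,p)` holds.** Inputs: Kim 2026 Thm. 1.8 (6) (`hKimk`, `hE67c`), Cassels–Tate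
(`hCT`), GZK, modularity — PUBLISHED — and the certificate (per-pair EVIDENCE, NOT a fact); the
one-factor socket with `α = e`. With `e = e₁ + e₂` the joint exponent of the two defect primes this
reaches the SPREAD rows of N10. Nothing booked; X4 CONSTRUCTION-SHAPED.
[cite: Kim2022StructureSelmer, Thm. 1.9 (6) and Conj. 1.10 (PDF p. 8)] [cite: SilvermanAEC2009, Thm. X.4.14]
[cite: Miller2011LMS, §1 and Def. 1.1] -/
theorem bsdp_of_plusSymbolLevelLowersAdditivelyModAt_of_tamagawa_le_succ_of_shaAn_unit_of_five_le
    (hKimk : Kim2026.rankZero_le_padicValNat_sha_of_kuriharaNumber_ne_zero)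
    (hE67c : Kim2026.rankZero_padicValNat_sha_add_le_of_forall_pow_dvd_kuriharaNumber_cyclicLevel)
    (hCT : exists_casselsTate_pairing (K := ℚ))
    (hGZK : rank_eq_analyticRank_of_analyticRank_le_one) (hmod : hasEntireLFunction_rat)
    (hp : 5 ≤ p) (hr : W.analyticRank = 0) (hsurj : W.HasSurjectiveModNGaloisRep p)
    {N : ℕ} [NeZero N] (D : ModularParametrizationData W N) (hN : W.conductorNorm ℤ = N)
    (hc : ¬ (p : ℤ) ∣ D.maninConstant)
    (hper : ∃ u : ℚ, ‖(u : ℚ_[p])‖ = 1 ∧ W.realPeriodRat = u * plusPeriod D.f)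
    {q' : ℚ} (hq' : shaAn W = (q' : ℂ)) (hv : padicValRat p q' = 0)
    {e : ℕ} {ℓ₁ ℓ₂ : ℕ} (hcert : PlusSymbolLevelLowersAdditivelyModAt W p D.f (p ^ e) ℓ₁ ℓ₂)
    (hℓ₁ : ℓ₁ ∣ W.conductorNorm ℤ) (hℓ₂ : ℓ₂ ∣ W.conductorNorm ℤ)
    (hce : padicValNat p W.tamagawaProduct ≤ e + 1) : BSDp W p := by
  have hirr := hasIrreducibleModPGaloisRep_of_hasSurjectiveModNGaloisRep W p hsurj
  have he : (e : ℕ∞) ≤ kuriharaPartialInfty W p D.f :=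
    le_kuriharaPartialInfty_of_plusSymbolLevelLowersAdditivelyModAt (by omega) hirr D hN hcert hℓ₁ hℓ₂
  exact bsdp_of_le_kimDefect_of_tamagawa_le_add_one_of_shaAn_unit W p hKimk hE67c hCT hGZK hmod hp hr
    hsurj D hN hc hper hq' hv he hce

/-- **The `ord_p ∏ c ≤ e + 1` closure at `p ≥ 5` on an OPTIMAL conductor-level datum** (period transfer
by optimality, `X4.periodTransfer_of_optimal`) from the additive certificate — the census shape.
[cite: Kim2022StructureSelmer, Thm. 1.9 (6) and Conj. 1.10 (PDF p. 8)] [cite: SilvermanAEC2009, Thm. X.4.14]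
[cite: Miller2011LMS, §1 and Def. 1.1] [cite: CremonaAlgorithms1997, §2.8 (p. 26)] -/
theorem bsdp_of_plusSymbolLevelLowersAdditivelyModAt_of_tamagawa_le_succ_of_shaAn_unit_of_optimal_of_five_le
    (hKimk : Kim2026.rankZero_le_padicValNat_sha_of_kuriharaNumber_ne_zero)
    (hE67c : Kim2026.rankZero_padicValNat_sha_add_le_of_forall_pow_dvd_kuriharaNumber_cyclicLevel)
    (hCT : exists_casselsTate_pairing (K := ℚ))
    (hGZK : rank_eq_analyticRank_of_analyticRank_le_one) (hmod : hasEntireLFunction_rat)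
    (hp : 5 ≤ p) (hr : W.analyticRank = 0) (hsurj : W.HasSurjectiveModNGaloisRep p)
    {N : ℕ} [NeZero N] (D : ModularParametrizationData W N) (hN : W.conductorNorm ℤ = N)
    (hopt : ∀ z ∈ D.L.lattice, ∃ w ∈ periodLattice D.f, z = D.c * w)
    (hc : ¬ (p : ℤ) ∣ D.maninConstant)
    {q' : ℚ} (hq' : shaAn W = (q' : ℂ)) (hv : padicValRat p q' = 0)
    {e : ℕ} {ℓ₁ ℓ₂ : ℕ} (hcert : PlusSymbolLevelLowersAdditivelyModAt W p D.f (p ^ e) ℓ₁ ℓ₂)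
    (hℓ₁ : ℓ₁ ∣ W.conductorNorm ℤ) (hℓ₂ : ℓ₂ ∣ W.conductorNorm ℤ)
    (hce : padicValNat p W.tamagawaProduct ≤ e + 1) : BSDp W p :=
  bsdp_of_plusSymbolLevelLowersAdditivelyModAt_of_tamagawa_le_succ_of_shaAn_unit_of_five_le W p hKimk hE67c hCT
    hGZK hmod hp hr hsurj D hN hc (periodTransfer_of_optimal p D hopt hc) hq' hv hcert hℓ₁ hℓ₂ hce

/-- **On an additively-certified unit row with `ord_p ∏_v c_v ≤ e + 1` (`p ≥ 5`), Kim's Conjecture 1.10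
HOLDS at the pair**: `KimTamagawaDefectAt W p D.f`, i.e. `∂^{(∞)}(δ̃_{D.f}) = ord_p ∏_v c_v` EXACTLY —
from the closure above and gen 17's iff `bsdp_iff_kimTamagawaDefectAt_of_kimFacts_of_five_le`
(PUBLISHED inputs). Consequence for the instrument: the additive certificate can hold at most up to the
exponent `ord_p ∏_v c_v` on such a row (E8 FREE's `e₁ + e₂` is sharp from above).
[cite: Kim2022StructureSelmer, Thm. 1.9 (6) and Conj. 1.10 (PDF p. 8)] [cite: SilvermanAEC2009, Thm. X.4.14]
[cite: Miller2011LMS, §1 and Def. 1.1] -/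
theorem kimTamagawaDefectAt_of_plusSymbolLevelLowersAdditivelyModAt_of_tamagawa_le_succ_of_shaAn_unit_of_five_le
    (hKimk : Kim2026.rankZero_le_padicValNat_sha_of_kuriharaNumber_ne_zero)
    (hE67c : Kim2026.rankZero_padicValNat_sha_add_le_of_forall_pow_dvd_kuriharaNumber_cyclicLevel)
    (hCT : exists_casselsTate_pairing (K := ℚ))
    (hGZK : rank_eq_analyticRank_of_analyticRank_le_one) (hmod : hasEntireLFunction_rat)
    (hp : 5 ≤ p) (hr : W.analyticRank = 0) (hsurj : W.HasSurjectiveModNGaloisRep p)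
    {N : ℕ} [NeZero N] (D : ModularParametrizationData W N) (hN : W.conductorNorm ℤ = N)
    (hc : ¬ (p : ℤ) ∣ D.maninConstant)
    (hper : ∃ u : ℚ, ‖(u : ℚ_[p])‖ = 1 ∧ W.realPeriodRat = u * plusPeriod D.f)
    {q' : ℚ} (hq' : shaAn W = (q' : ℂ)) (hv : padicValRat p q' = 0)
    {e : ℕ} {ℓ₁ ℓ₂ : ℕ} (hcert : PlusSymbolLevelLowersAdditivelyModAt W p D.f (p ^ e) ℓ₁ ℓ₂)
    (hℓ₁ : ℓ₁ ∣ W.conductorNorm ℤ) (hℓ₂ : ℓ₂ ∣ W.conductorNorm ℤ)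
    (hce : padicValNat p W.tamagawaProduct ≤ e + 1) : KimTamagawaDefectAt W p D.f :=
  (bsdp_iff_kimTamagawaDefectAt_of_kimFacts_of_five_le W p hKimk hE67c hGZK hmod hp hr hsurj D hN hc
    hper).mp
    (bsdp_of_plusSymbolLevelLowersAdditivelyModAt_of_tamagawa_le_succ_of_shaAn_unit_of_five_le W p hKimk hE67c
      hCT hGZK hmod hp hr hsurj D hN hc hper hq' hv hcert hℓ₁ hℓ₂ hce)

end RankZeroFiveLe

/-! ### §2 Analytic rank `0`, `p ≥ 3` unit TOWER rows (N11 at `p = 3`), CONDITIONAL on the announced Kim 2025 clause -/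

section RankZeroTower

/-- **THE `ord_p ∏ c ≤ e + 1` CLOSURE at `p ≥ 3` on a unit TOWER row from the ADDITIVE certificate,
CONDITIONAL on the preprint** (`hK25s`, flag `Kim2025-preprint`): analytic rank `0`, `ρ̄_{E,p^n}` onto for
all `n`, conductor-level datum `D` with the period transfer, `#Ш_an = q'` a `p`-unit,
`ord_p ∏_v c_v ≤ e + 1`, and `PlusSymbolLevelLowersAdditivelyModAt W p D.f (p^e) ℓ₁ ℓ₂` at two divisors `ℓ₁, ℓ₂` of
`N_E` ⟹ `BSD(E,p)`. At `p = 3` with `e = e₁ + e₂` this is the N11 SPREAD sub-row (27 sweep rows with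
two Tamagawa primes beyond the single-prime slack, gen 29 census), per pair, on one finite
certificate. [claim: Kim2025RefinedTNC, status: under-review]
[cite: Kim2025RefinedTNC, Thm. 1.1 ("BSD") (ANNOUNCED, OPEN binder)] [cite: SilvermanAEC2009, Thm. X.4.14]
[cite: Kim2022StructureSelmer, Conj. 1.10 (PDF p. 8)] [cite: Miller2011LMS, §1 and Def. 1.1] -/
theorem bsdp_of_plusSymbolLevelLowersAdditivelyModAt_of_tamagawa_le_succ_of_shaAn_unit_of_kim2025_OPEN
    (hK25s : Kim2025.thm11_kimShaLength_of_integralPeriod_OPEN)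
    (hCT : exists_casselsTate_pairing (K := ℚ))
    (hGZK : rank_eq_analyticRank_of_analyticRank_le_one) (hmod : hasEntireLFunction_rat)
    (hp3 : 3 ≤ p) (hr : W.analyticRank = 0) (htower : ∀ n : ℕ, W.HasSurjectiveModNGaloisRep (p ^ n : ℕ))
    {N : ℕ} [NeZero N] (D : ModularParametrizationData W N) (hN : W.conductorNorm ℤ = N)
    (hper : ∃ u : ℚ, ‖(u : ℚ_[p])‖ = 1 ∧ W.realPeriodRat = u * plusPeriod D.f)
    {q' : ℚ} (hq' : shaAn W = (q' : ℂ)) (hv : padicValRat p q' = 0)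
    {e : ℕ} {ℓ₁ ℓ₂ : ℕ} (hcert : PlusSymbolLevelLowersAdditivelyModAt W p D.f (p ^ e) ℓ₁ ℓ₂)
    (hℓ₁ : ℓ₁ ∣ W.conductorNorm ℤ) (hℓ₂ : ℓ₂ ∣ W.conductorNorm ℤ)
    (hce : padicValNat p W.tamagawaProduct ≤ e + 1) : BSDp W p := by
  have hsurj : W.HasSurjectiveModNGaloisRep p := by simpa using htower 1
  have hirr := hasIrreducibleModPGaloisRep_of_hasSurjectiveModNGaloisRep W p hsurj
  have he : (e : ℕ∞) ≤ kuriharaPartialInfty W p D.f :=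
    le_kuriharaPartialInfty_of_plusSymbolLevelLowersAdditivelyModAt (by omega) hirr D hN hcert hℓ₁ hℓ₂
  exact Additive.bsdp_of_le_kimDefect_of_tamagawa_le_add_one_of_shaAn_unit_of_kim2025_OPEN W p hK25s
    hCT hGZK hmod hp3 hr htower D hper hq' hv he hce

/-- **The `p ≥ 3` closure on an OPTIMAL conductor-level datum with `p ∤ c`, CONDITIONAL on the preprint**
— the census shape for Cremona's optimal curves at `3`, additive certificate from the seat's
instrument E9b. [claim: Kim2025RefinedTNC, status: under-review]
[cite: Kim2025RefinedTNC, Thm. 1.1 ("BSD") (ANNOUNCED, OPEN binder)] [cite: SilvermanAEC2009, Thm. X.4.14]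
[cite: CremonaAlgorithms1997, §2.8 (p. 26)] -/
theorem bsdp_of_plusSymbolLevelLowersAdditivelyModAt_of_tamagawa_le_succ_of_shaAn_unit_of_optimal_of_kim2025_OPEN
    (hK25s : Kim2025.thm11_kimShaLength_of_integralPeriod_OPEN)
    (hCT : exists_casselsTate_pairing (K := ℚ))
    (hGZK : rank_eq_analyticRank_of_analyticRank_le_one) (hmod : hasEntireLFunction_rat)
    (hp3 : 3 ≤ p) (hr : W.analyticRank = 0) (htower : ∀ n : ℕ, W.HasSurjectiveModNGaloisRep (p ^ n : ℕ))
    {N : ℕ} [NeZero N] (D : ModularParametrizationData W N) (hN : W.conductorNorm ℤ = N)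
    (hopt : ∀ z ∈ D.L.lattice, ∃ w ∈ periodLattice D.f, z = D.c * w)
    (hc : ¬ (p : ℤ) ∣ D.maninConstant)
    {q' : ℚ} (hq' : shaAn W = (q' : ℂ)) (hv : padicValRat p q' = 0)
    {e : ℕ} {ℓ₁ ℓ₂ : ℕ} (hcert : PlusSymbolLevelLowersAdditivelyModAt W p D.f (p ^ e) ℓ₁ ℓ₂)
    (hℓ₁ : ℓ₁ ∣ W.conductorNorm ℤ) (hℓ₂ : ℓ₂ ∣ W.conductorNorm ℤ)
    (hce : padicValNat p W.tamagawaProduct ≤ e + 1) : BSDp W p :=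
  bsdp_of_plusSymbolLevelLowersAdditivelyModAt_of_tamagawa_le_succ_of_shaAn_unit_of_kim2025_OPEN W p hK25s hCT
    hGZK hmod hp3 hr htower D hN (periodTransfer_of_optimal p D hopt hc) hq' hv hcert hℓ₁ hℓ₂ hce

/-- **The `p ≥ 3` tower exactness, CONDITIONAL on the preprint**: on an additively-certified unit tower
row with `ord_p ∏_v c_v ≤ e + 1`, Kim's Conjecture 1.10 holds at the pair modulo `Kim2025…_OPEN` — at
`p = 3` the E1 prediction for the Kurihara lanes on the SPREAD rows: EVERY cyclic `δ̃_n` vanishes mod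
`3^{T}` at the levels `n ∈ 𝒩_T`, `T = ord₃ ∏ c`, and some cyclic level has valuation exactly `T`.
[claim: Kim2025RefinedTNC, status: under-review]
[cite: Kim2025RefinedTNC, Thm. 1.1 ("BSD") (ANNOUNCED, OPEN binder)] [cite: Kim2022StructureSelmer, Conj. 1.10 (PDF p. 8)] -/
theorem kimTamagawaDefectAt_of_plusSymbolLevelLowersAdditivelyModAt_of_tamagawa_le_succ_of_shaAn_unit_of_kim2025_OPEN
    (hK25s : Kim2025.thm11_kimShaLength_of_integralPeriod_OPEN)
    (hCT : exists_casselsTate_pairing (K := ℚ))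
    (hGZK : rank_eq_analyticRank_of_analyticRank_le_one) (hmod : hasEntireLFunction_rat)
    (hp3 : 3 ≤ p) (hr : W.analyticRank = 0) (htower : ∀ n : ℕ, W.HasSurjectiveModNGaloisRep (p ^ n : ℕ))
    {N : ℕ} [NeZero N] (D : ModularParametrizationData W N) (hN : W.conductorNorm ℤ = N)
    (hper : ∃ u : ℚ, ‖(u : ℚ_[p])‖ = 1 ∧ W.realPeriodRat = u * plusPeriod D.f)
    {q' : ℚ} (hq' : shaAn W = (q' : ℂ)) (hv : padicValRat p q' = 0)
    {e : ℕ} {ℓ₁ ℓ₂ : ℕ} (hcert : PlusSymbolLevelLowersAdditivelyModAt W p D.f (p ^ e) ℓ₁ ℓ₂)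
    (hℓ₁ : ℓ₁ ∣ W.conductorNorm ℤ) (hℓ₂ : ℓ₂ ∣ W.conductorNorm ℤ)
    (hce : padicValNat p W.tamagawaProduct ≤ e + 1) : KimTamagawaDefectAt W p D.f := by
  have hp2 : p ≠ 2 := by omega
  have hint := Additive.forall_padicValRat_ratPlusSymbol_nonneg_of_towerSurj hp2 D.isNewformOf htower
  exact (Additive.bsdp_iff_kimTamagawaDefectAt_of_kim2025_OPEN W p hK25s hGZK hmod hp3 hr htower D hper
    hint).mp
    (bsdp_of_plusSymbolLevelLowersAdditivelyModAt_of_tamagawa_le_succ_of_shaAn_unit_of_kim2025_OPEN W p hK25s hCT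
      hGZK hmod hp3 hr htower D hN hper hq' hv hcert hℓ₁ hℓ₂ hce)

end RankZeroTower

/-! ### §3 Analytic rank `1`: the additive certificate plus ONE Kurihara number `≢ 0 (mod p^{e+1})` -/

section RankOne

/-- **`ord_p #Ш(E/ℚ)(p) + e ≤ k − 1`** from the rank-one `∂`-clause `hK`, the ADDITIVE (two-prime `τ`-system) mod-`p^e`
certificate (`∂^{(∞)} ≥ e`) and ONE `δ̃_ℓ ≢ 0 (mod p^k)` at a cyclic Kolyvagin prime `ℓ ∈ 𝒫_k`
(`∂^{(1)} ≤ k − 1`). ANY reduction at `p`; `hK` explicit; per pair.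
[cite: Kim2022StructureSelmer, Thm. 1.9 (6) and §1.5.1 (PDF pp. 7–8)] -/
theorem padicValNat_primaryComponent_add_le_of_partial_of_plusSymbolLevelLowersAdditivelyModAt
    (hK : KimRankOnePartialAt W p) (hp2 : p ≠ 2)
    (hsurj : W.HasSurjectiveModNGaloisRep p)
    (htower : ∀ n : ℕ, W.HasSurjectiveModNGaloisRep (p ^ n : ℕ)) (hL : W.entireLFunction 1 = 0)
    (hr : W.analyticRank = 1) (hfin : Finite W.sha)
    {N : ℕ} [NeZero N] (D : ModularParametrizationData W N) (hN : W.conductorNorm ℤ = N)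
    (hc : ¬ (p : ℤ) ∣ D.maninConstant)
    (hper : ∃ u : ℚ, ‖(u : ℚ_[p])‖ = 1 ∧ W.realPeriodRat = u * plusPeriod D.f)
    {e : ℕ} {ℓ₁ ℓ₂ : ℕ} (hcert : PlusSymbolLevelLowersAdditivelyModAt W p D.f (p ^ e) ℓ₁ ℓ₂)
    (hℓ₁ : ℓ₁ ∣ W.conductorNorm ℤ) (hℓ₂ : ℓ₂ ∣ W.conductorNorm ℤ)
    {k : ℕ} (hk : 1 ≤ k) (ℓ : ℕ) [Fact ℓ.Prime] (hℓ : Kato.IsKolyvaginPrime W p k ℓ)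
    (hcyc : Nat.card {P : ((WeierstrassCurve.integralModelInt W).map
        (Int.castRingHom (ZMod ℓ))).toAffine.Point // p • P = 0} ≤ p)
    (ψ : (ℓ' : ℕ) → (ZMod ℓ')ˣ →* Multiplicative (ZMod (p ^ k)))
    (hψ : Function.Surjective (ψ ℓ)) (hδ : kuriharaNumber D.f (p ^ k) ℓ ψ ≠ 0) :
    padicValNat p (Nat.card (AddCommGroup.primaryComponent W.sha p)) + e ≤ k - 1 := by
  have hirr := hasIrreducibleModPGaloisRep_of_hasSurjectiveModNGaloisRep W p hsurj
  have he : ((e : ℕ) : ℕ∞) ≤ kuriharaPartialInfty W p D.f :=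
    le_kuriharaPartialInfty_of_plusSymbolLevelLowersAdditivelyModAt hp2 hirr D hN hcert hℓ₁ hℓ₂
  exact padicValNat_primaryComponent_add_le_of_partial_of_le_partialInfty W p hK hsurj htower hL hr hfin
    D hc hper he hk ℓ hℓ hcyc ψ hψ hδ

/-- **Level `e + 1` gives `#Ш(E/ℚ)(p) = 1`, Cassels–Tate-free, with `e` the JOINT exponent**: under the
additive mod-`p^e` certificate, ONE `δ̃_ℓ ≢ 0 (mod p^{e+1})` at a cyclic `ℓ ∈ 𝒫_{e+1}`. Rank one,
`hK` explicit; ANY reduction at `p`; per pair. [cite: Kim2022StructureSelmer, Thm. 1.9 (6) and §1.5.1 (PDF pp. 7–8)] -/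
theorem card_primaryComponent_eq_one_of_partial_of_plusSymbolLevelLowersAdditivelyModAt_levelSucc
    (hK : KimRankOnePartialAt W p) (hp2 : p ≠ 2)
    (hsurj : W.HasSurjectiveModNGaloisRep p)
    (htower : ∀ n : ℕ, W.HasSurjectiveModNGaloisRep (p ^ n : ℕ)) (hL : W.entireLFunction 1 = 0)
    (hr : W.analyticRank = 1) (hfin : Finite W.sha)
    {N : ℕ} [NeZero N] (D : ModularParametrizationData W N) (hN : W.conductorNorm ℤ = N)
    (hc : ¬ (p : ℤ) ∣ D.maninConstant)
    (hper : ∃ u : ℚ, ‖(u : ℚ_[p])‖ = 1 ∧ W.realPeriodRat = u * plusPeriod D.f)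
    {e : ℕ} {ℓ₁ ℓ₂ : ℕ} (hcert : PlusSymbolLevelLowersAdditivelyModAt W p D.f (p ^ e) ℓ₁ ℓ₂)
    (hℓ₁ : ℓ₁ ∣ W.conductorNorm ℤ) (hℓ₂ : ℓ₂ ∣ W.conductorNorm ℤ)
    (ℓ : ℕ) [Fact ℓ.Prime] (hℓ : Kato.IsKolyvaginPrime W p (e + 1) ℓ)
    (hcyc : Nat.card {P : ((WeierstrassCurve.integralModelInt W).map
        (Int.castRingHom (ZMod ℓ))).toAffine.Point // p • P = 0} ≤ p)
    (ψ : (ℓ' : ℕ) → (ZMod ℓ')ˣ →* Multiplicative (ZMod (p ^ (e + 1))))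
    (hψ : Function.Surjective (ψ ℓ)) (hδ : kuriharaNumber D.f (p ^ (e + 1)) ℓ ψ ≠ 0) :
    Nat.card (AddCommGroup.primaryComponent W.sha p) = 1 := by
  haveI : Finite W.sha := hfin
  have h := padicValNat_primaryComponent_add_le_of_partial_of_plusSymbolLevelLowersAdditivelyModAt W p hK hp2
    hsurj htower hL hr hfin D hN hc hper hcert hℓ₁ hℓ₂ (by omega) ℓ hℓ hcyc ψ hψ hδ
  exact card_primaryComponent_eq_one_of_padicValNat_eq_zero W p (by omega)

/-- **`BSD(E,p)` on a rank-one Tamagawa row from the ADDITIVE certificate + ONE Kurihara number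
mod `p^{e+1}`**, Cassels–Tate-free: `#Ш(E/ℚ)(p) = 1`, the lane's `#Ш_an = q` with `ord_p q = 0`, GZK,
modularity. With `e = e₁ + e₂` the whole multiplicative Tamagawa exponent of a row with two defect
primes, the row is decided at level `ord_p ∏ c + 1` with NO Cassels–Tate step (gen 29 needed
level `e + 2` + CT whenever a second defect prime was present). Rank one, `hK` explicit; per pair;
nothing booked. [cite: Kim2022StructureSelmer, Thm. 1.9 (6) (PDF p. 8)] [cite: Miller2011LMS, Def. 1.1] -/
theorem bsdp_of_partial_of_plusSymbolLevelLowersAdditivelyModAt_levelSucc_of_shaAn_unit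
    (hK : KimRankOnePartialAt W p) (hp2 : p ≠ 2)
    (hGZK : rank_eq_analyticRank_of_analyticRank_le_one) (hmod : hasEntireLFunction_rat)
    (hsurj : W.HasSurjectiveModNGaloisRep p)
    (htower : ∀ n : ℕ, W.HasSurjectiveModNGaloisRep (p ^ n : ℕ)) (hr : W.analyticRank = 1)
    {N : ℕ} [NeZero N] (D : ModularParametrizationData W N) (hN : W.conductorNorm ℤ = N)
    (hc : ¬ (p : ℤ) ∣ D.maninConstant)
    (hper : ∃ u : ℚ, ‖(u : ℚ_[p])‖ = 1 ∧ W.realPeriodRat = u * plusPeriod D.f)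
    {e : ℕ} {ℓ₁ ℓ₂ : ℕ} (hcert : PlusSymbolLevelLowersAdditivelyModAt W p D.f (p ^ e) ℓ₁ ℓ₂)
    (hℓ₁ : ℓ₁ ∣ W.conductorNorm ℤ) (hℓ₂ : ℓ₂ ∣ W.conductorNorm ℤ)
    (ℓ : ℕ) [Fact ℓ.Prime] (hℓ : Kato.IsKolyvaginPrime W p (e + 1) ℓ)
    (hcyc : Nat.card {P : ((WeierstrassCurve.integralModelInt W).map
        (Int.castRingHom (ZMod ℓ))).toAffine.Point // p • P = 0} ≤ p)
    (ψ : (ℓ' : ℕ) → (ZMod ℓ')ˣ →* Multiplicative (ZMod (p ^ (e + 1))))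
    (hψ : Function.Surjective (ψ ℓ)) (hδ : kuriharaNumber D.f (p ^ (e + 1)) ℓ ψ ≠ 0)
    {q : ℚ} (hq : shaAn W = (q : ℂ)) (hv : padicValRat p q = 0) : BSDp W p := by
  have hL : W.entireLFunction 1 = 0 := by
    by_contra hne
    have h0 := (W.analyticRank_eq_zero_iff_holds (hmod W)).mpr hne
    omega
  obtain ⟨hmw, hfin⟩ := hGZK W (by rw [hr])
  have hcard := card_primaryComponent_eq_one_of_partial_of_plusSymbolLevelLowersAdditivelyModAt_levelSucc W p
    hK hp2 hsurj htower hL hr hfin D hN hc hper hcert hℓ₁ hℓ₂ ℓ hℓ hcyc ψ hψ hδ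
  exact (bsdp_iff_padicValRat_eq_zero_of_card_primaryComponent_eq_one W p hmw hfin hcard hq).mpr hv

/-- **`p ≥ 5`, level `e + 1`, Cassels–Tate-free, PUBLISHED inputs + the ADDITIVE certificate**: E73
(`hE73`), `ρ̄_{E,p}` + tower onto, `r_an = 1`, conductor-level datum `D` with `p ∤ c_D` + period transfer,
the certificate at two divisors `ℓ₁, ℓ₂` of `N_E`, ONE `δ̃_ℓ ≢ 0 (mod p^{e+1})` at a cyclic
`ℓ ∈ 𝒫_{e+1}`, `#Ш_an` a `p`-unit ⟹ `BSD(E,p)`. The O7 ∩ X4 Tamagawa rows with SEVERAL defect primes.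
ANY reduction at `p`; per pair; nothing booked. [cite: Kim2022StructureSelmer, Thm. 1.9 (6) (PDF p. 8)]
[cite: Miller2011LMS, Def. 1.1] -/
theorem bsdp_of_plusSymbolLevelLowersAdditivelyModAt_levelSucc_rankOne_of_shaAn_unit_of_five_le
    (hE73 : Kim2026.kuriharaPartial_vanishingOrder_eq_padicValNat_sha_add_partialInfty_of_maninConstant)
    (hGZK : rank_eq_analyticRank_of_analyticRank_le_one) (hmod : hasEntireLFunction_rat)
    (hp : 5 ≤ p) (hsurj : W.HasSurjectiveModNGaloisRep p)
    (htower : ∀ n : ℕ, W.HasSurjectiveModNGaloisRep (p ^ n : ℕ)) (hr : W.analyticRank = 1)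
    {N : ℕ} [NeZero N] (D : ModularParametrizationData W N) (hN : W.conductorNorm ℤ = N)
    (hc : ¬ (p : ℤ) ∣ D.maninConstant)
    (hper : ∃ u : ℚ, ‖(u : ℚ_[p])‖ = 1 ∧ W.realPeriodRat = u * plusPeriod D.f)
    {e : ℕ} {ℓ₁ ℓ₂ : ℕ} (hcert : PlusSymbolLevelLowersAdditivelyModAt W p D.f (p ^ e) ℓ₁ ℓ₂)
    (hℓ₁ : ℓ₁ ∣ W.conductorNorm ℤ) (hℓ₂ : ℓ₂ ∣ W.conductorNorm ℤ)
    (ℓ : ℕ) [Fact ℓ.Prime] (hℓ : Kato.IsKolyvaginPrime W p (e + 1) ℓ)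
    (hcyc : Nat.card {P : ((WeierstrassCurve.integralModelInt W).map
        (Int.castRingHom (ZMod ℓ))).toAffine.Point // p • P = 0} ≤ p)
    (ψ : (ℓ' : ℕ) → (ZMod ℓ')ˣ →* Multiplicative (ZMod (p ^ (e + 1))))
    (hψ : Function.Surjective (ψ ℓ)) (hδ : kuriharaNumber D.f (p ^ (e + 1)) ℓ ψ ≠ 0)
    {q : ℚ} (hq : shaAn W = (q : ℂ)) (hv : padicValRat p q = 0) : BSDp W p :=
  bsdp_of_partial_of_plusSymbolLevelLowersAdditivelyModAt_levelSucc_of_shaAn_unit W p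
    (kimRankOnePartialAt_of_kim2026_of_five_le W p hE73 hp) (by omega) hGZK hmod hsurj htower hr D hN
    hc hper hcert hℓ₁ hℓ₂ ℓ hℓ hcyc ψ hψ hδ hq hv

end RankOne

/-! ### §4 `p = 3`, rank `1`, MODULO the conjecture `X4SharpThreeKimRankOnePartial` -/

section Three

variable (W : WeierstrassCurve ℚ) [W.IsElliptic] [W.IsGloballyMinimal]

/-- **O7 ∩ X4@3, rank-one Tamagawa row with SEVERAL defect primes, additive mod-`3^e` certificate +
level `e + 1`, Cassels–Tate-free, MODULO the conjecture** `X4SharpThreeKimRankOnePartial` (`h3`; printed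
reason Kim 2025 Thm. 1.1 (Str), PREPRINT): on `ClassX4 W 3` ∧ `r_an = 1` with surj(3) and a tower
certificate, a conductor-level datum `D` with `3 ∤ c_D` and period transfer, the additive certificate
at two divisors `ℓ₁, ℓ₂` of `N_E`, ONE `δ̃_ℓ ≢ 0 (mod 3^{e+1})` at a cyclic `ℓ ∈ 𝒫_{e+1}(E,3)` and
`#Ш_an = q` a `3`-unit: `BSD(E,3)`. The 5 999 rank-one `T = e_{single} + 1` rows of gen 29 at level
`T + 1` instead of `T + 2` + CT, once the joint exponent reaches `T` (E8 FREE / E9b). Per pair; NOT a class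
theorem; nothing booked. [cite: Kim2022StructureSelmer, Thm. 1.9 (6) (PDF p. 8)]
[cite: Kim2025RefinedTNC, Thm. 1.1 (Str) (PDF p. 4; ANNOUNCED preprint — the reason, not a source of truth)]
[cite: Miller2011LMS, Def. 1.1] -/
theorem X4RankOne.bsdp_three_of_partial_of_plusSymbolLevelLowersAdditivelyModAt_levelSucc
    (h3 : X4SharpThreeKimRankOnePartial)
    (hGZK : rank_eq_analyticRank_of_analyticRank_le_one) (hmod : hasEntireLFunction_rat)
    (hX : ClassX4 W 3) (hsurj : W.HasSurjectiveModNGaloisRep 3)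
    (htower : ∀ n : ℕ, W.HasSurjectiveModNGaloisRep (3 ^ n : ℕ)) (hr : W.analyticRank = 1)
    {N : ℕ} [NeZero N] (D : ModularParametrizationData W N) (hN : W.conductorNorm ℤ = N)
    (hc : ¬ (3 : ℤ) ∣ D.maninConstant)
    (hper : ∃ u : ℚ, ‖(u : ℚ_[3])‖ = 1 ∧ W.realPeriodRat = u * plusPeriod D.f)
    {e : ℕ} {ℓ₁ ℓ₂ : ℕ} (hcert : PlusSymbolLevelLowersAdditivelyModAt W 3 D.f (3 ^ e) ℓ₁ ℓ₂)
    (hℓ₁ : ℓ₁ ∣ W.conductorNorm ℤ) (hℓ₂ : ℓ₂ ∣ W.conductorNorm ℤ)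
    (ℓ : ℕ) [Fact ℓ.Prime] (hℓ : Kato.IsKolyvaginPrime W 3 (e + 1) ℓ)
    (hcyc : Nat.card {P : ((WeierstrassCurve.integralModelInt W).map
        (Int.castRingHom (ZMod ℓ))).toAffine.Point // 3 • P = 0} ≤ 3)
    (ψ : (ℓ' : ℕ) → (ZMod ℓ')ˣ →* Multiplicative (ZMod (3 ^ (e + 1))))
    (hψ : Function.Surjective (ψ ℓ)) (hδ : kuriharaNumber D.f (3 ^ (e + 1)) ℓ ψ ≠ 0)
    {q : ℚ} (hq : shaAn W = (q : ℂ)) (hv : padicValRat 3 q = 0) : BSDp W 3 :=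
  bsdp_of_partial_of_plusSymbolLevelLowersAdditivelyModAt_levelSucc_of_shaAn_unit W 3
    (kimRankOnePartialAt_three_of_classX4 W h3 hX) (by norm_num) hGZK hmod hsurj htower hr D hN hc
    hper hcert hℓ₁ hℓ₂ ℓ hℓ hcyc ψ hψ hδ hq hv

end Three

end Summit.BirchSwinnertonDyer.Rank1Residual.X4

end
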